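import Mathlib
import HarnessLib
import Literature.AlgebraicGeometry.Resolution.AffineBlowupRegular
import Summits.ResolutionOfSingularities.ResolutionOfSingularities.Theorems.WildQuotientsWildQuotientResolutionJordanFiveVertexCover
import Summits.ResolutionOfSingularities.ResolutionOfSingularities.Theorems.WildQuotientsWildQuotientResolutionPrincipalChartRees
import Summits.ResolutionOfSingularities.ResolutionOfSingularities.Theorems.WildQuotientsWildQuotientResolutionToricExitChartStable

/-!
# ℤ9 SPECIMEN (peeled `𝔸⁴/ℤ9`, char 3), brick Z3 part 1: `V = Bl_{I₂₈} 𝔸ⁿ` is covered by its three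
# vertex charts `D₊(x_a⁴ t) ∪ D₊(x_b⁷ t) ∪ D₊(x_c²⁸ t)`; the `x_a`-vertex chart is `⟨σ̄⟩`-stable
(crux stmt-ResolutionOfSingularities-15640 `WildQuotients.WildQuotientResolution`, line `Sketch`; S1 =
stmt-ResolutionOfSingularities-17941 `CyclicQuotientFourfolds`, non-linear sector; chain w45c card P specimen
«peeled 𝔸⁴/ℤ9» — res-L1-w45c-idea-2 memo `L/res-L1-w45c-idea-2/cardP_g12/Z9-SPECIMEN.md` §1 «VERTEX COVER» /
§4 brick Z3, res-L1-w45c-plan-1 GO 2026-08-27T16:29:20Z + CLARIFICATION 16:29:52Z («Z3 cover/stable pieces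
= 033», letter defaults); moulds `JordanFour.iSup_vertexCharts_I6_eq_top` (…JordanFourCover) and the generic
certificate lemmas `JordanFive.basicOpen_reesT_le_of_sq_eq/_of_cube_eq` (…JordanFiveVertexCover, imported, not
restated). [OURS · L1 W4.5c] — NOT a statement of any manuscript; replaces the role of no printed item;
AI-produced, weaker than expert review. Def-free; python-emitted certificates
(`D/res-D-pv-033/work-gen8/gen_cover.py`). Prover res-D-pv-033.)

`V = Bl_{I₂₈} 𝔸ⁿ = Proj k[x][I₂₈ t]` for the ABSTRACT generator vector `g : Fin 24 → k[x]` of `I₂₈` with the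
exponent TABLE of record (the `(7,4,1)`-weight-`≥ 28` monomials in `x_a, x_b, x_c`; `…Z9PeeledI28Stable`):
`![(4, 0, 0), (3, 2, 0), (3, 1, 3), (3, 0, 7), (2, 4, 0), (2, 3, 2), (2, 2, 6), (2, 1, 10), (2, 0, 14), (1, 6, 0), (1, 5, 1), (1, 4, 5), (1, 3, 9), (1, 2, 13), (1, 1, 17), (1, 0, 21), (0, 7, 0), (0, 6, 4), (0, 5, 8), (0, 4, 12), (0, 3, 16), (0, 2, 20), (0, 1, 24), (0, 0, 28)]`.
The three VERTEX charts are `D₊(g 0 · t) = D₊(x_a⁴t)` (the `μ₇` root chart, cone `¹⁄₇(1,3,6) × 𝔸`),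
`D₊(g 16 · t) = D₊(x_b⁷t)` (the `μ₄` root chart) and `D₊(g 23 · t) = D₊(x_c²⁸t)` (smooth chart) — memo §2.

* **`iSup_vertexCharts_eq_top`** — `D₊(x_a⁴t) ⊔ D₊(x_b⁷t) ⊔ D₊(x_c²⁸t) = ⊤`: the 24 generator charts cover
  (`affineBlowup.iSup_basicOpen_reesT_generators_eq_top`, Stacks 0804) and each of the 21 non-vertex charts
  lies in a vertex chart by an explicit Rees identity `(g_q t)² = (g_v t)(r t)`, `r ∈ I₂₈` (19 cases; e.g.
  `(x_a²x_b⁴ t)² = (x_a⁴ t)(x_b⁷ · x_b t)`) or `(g_q t)³ = (g_v t)(g_r t)(g_s t)` (`q = 12, 13`: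
  `(x_ax_b³x_c⁹)³ = x_b⁷ · x_a³x_bx_c³ · x_bx_c²⁴`, `(x_ax_b²x_c¹³)³ = x_c²⁸ · x_a³x_bx_c³ · x_b⁵x_c⁸`);
* `vertexCharts_cover_blowupChart` — the same cover in the principal-chart spelling `V[x_a⁴] ⊔ V[x_b⁷] ⊔ V[x_c²⁸] = ⊤`
  (`blowupChart (affineBlowup.π I) (affineBlowup.idealSheaf I) ⟨⊤,_⟩ (ι₀ (g j))`, via
  `ToricExit.blowupChart_affineBlowup_eq_basicOpen_reesT`) for scaffolds in the V3U/N4a mould;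
* `smul_g0_eq`, **`preimage_vertexChartA_eq`** — `γ • g 0 = g 0` on `⟨σ̄⟩` (`σ̄ x_a = x_a`) and the `x_a`-vertex
  chart `V[x_a⁴]` is stable under the lifted action (abstract `hJ`, affine-quotient law `ρ`), mould
  `JordanThreeTwo.preimage_chart_a_eq` / `ToricExit.preimage_blowupChart_eq_self_of_action`. (The `x_c`-vertex
  chart is NOT stable — `σ̄` moves `x_c` — and the `x_b`-vertex chart needs the twisted piece Z4T; the STABLE
  cover `P₀ ∪ P_T ∪ P₂` is assembled in part 2 once Z4T (res-L1-w45c-idea-2 `Z4T-TWIST.md`) and Z4b name their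
  pieces.)
-/

-- single-problem summit: the doubled namespace component `ResolutionOfSingularities` is forced
set_option linter.dupNamespace false

noncomputable section

open CategoryTheory AlgebraicGeometry TopologicalSpace MvPolynomial Polynomial
open scoped Pointwise
open Literature.AlgebraicGeometry.Resolution

namespace Summit.ResolutionOfSingularities.ResolutionOfSingularities.Theorems.WildQuotientResolution.Z9Peeled

variable (k : Type) [Field k] (n : ℕ) (a b c : Fin n)

/-- The exponent table of the 24 generators of `I₂₈` (memo §1 order; local shorthand, unfolds at
elaboration; used only inside theorem signatures). -/
local notation3 "e24" => (![(4, 0, 0), (3, 2, 0), (3, 1, 3), (3, 0, 7), (2, 4, 0), (2, 3, 2), (2, 2, 6), (2, 1, 10), (2, 0, 14), (1, 6, 0), (1, 5, 1), (1, 4, 5), (1, 3, 9), (1, 2, 13), (1, 1, 17), (1, 0, 21), (0, 7, 0), (0, 6, 4), (0, 5, 8), (0, 4, 12), (0, 3, 16), (0, 2, 20), (0, 1, 24), (0, 0, 28)] : Fin 24 → ℕ × ℕ × ℕ)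

-- 21 Rees certificates, each a `ring` identity after evaluating the table
set_option maxHeartbeats 2000000 in
/-- **The three vertex charts cover `Bl_{I₂₈} 𝔸ⁿ`**: `D₊(x_a⁴ t) ⊔ D₊(x_b⁷ t) ⊔ D₊(x_c²⁸ t) = ⊤` for every
vector `g` realising the exponent table. [OURS · L1 W4.5c] [folklore; 21 monomial certificates] -/
theorem iSup_vertexCharts_eq_top (g : Fin 24 → MvPolynomial (Fin n) k)
    (hg : ∀ q, g q = X a ^ (e24 q).1 * X b ^ (e24 q).2.1 * X c ^ (e24 q).2.2) :
    Proj.basicOpen (reesGrading (Ideal.span (Set.range g)))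
        (reesT (g 0) (Ideal.mem_span_range_self (f := g) (x := 0))) ⊔
      Proj.basicOpen (reesGrading (Ideal.span (Set.range g)))
        (reesT (g 16) (Ideal.mem_span_range_self (f := g) (x := 16))) ⊔
      Proj.basicOpen (reesGrading (Ideal.span (Set.range g)))
        (reesT (g 23) (Ideal.mem_span_range_self (f := g) (x := 23))) = ⊤ := by
  have m : ∀ q, g q ∈ Ideal.span (Set.range g) := fun q => Ideal.mem_span_range_self (f := g) (x := q)
  have hg0 : g 0 = X a ^ 4 * X b ^ 0 * X c ^ 0 := hg 0
  have hg1 : g 1 = X a ^ 3 * X b ^ 2 * X c ^ 0 := hg 1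
  have hg2 : g 2 = X a ^ 3 * X b ^ 1 * X c ^ 3 := hg 2
  have hg3 : g 3 = X a ^ 3 * X b ^ 0 * X c ^ 7 := hg 3
  have hg4 : g 4 = X a ^ 2 * X b ^ 4 * X c ^ 0 := hg 4
  have hg5 : g 5 = X a ^ 2 * X b ^ 3 * X c ^ 2 := hg 5
  have hg6 : g 6 = X a ^ 2 * X b ^ 2 * X c ^ 6 := hg 6
  have hg7 : g 7 = X a ^ 2 * X b ^ 1 * X c ^ 10 := hg 7
  have hg8 : g 8 = X a ^ 2 * X b ^ 0 * X c ^ 14 := hg 8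
  have hg9 : g 9 = X a ^ 1 * X b ^ 6 * X c ^ 0 := hg 9
  have hg10 : g 10 = X a ^ 1 * X b ^ 5 * X c ^ 1 := hg 10
  have hg11 : g 11 = X a ^ 1 * X b ^ 4 * X c ^ 5 := hg 11
  have hg12 : g 12 = X a ^ 1 * X b ^ 3 * X c ^ 9 := hg 12
  have hg13 : g 13 = X a ^ 1 * X b ^ 2 * X c ^ 13 := hg 13
  have hg14 : g 14 = X a ^ 1 * X b ^ 1 * X c ^ 17 := hg 14
  have hg15 : g 15 = X a ^ 1 * X b ^ 0 * X c ^ 21 := hg 15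
  have hg16 : g 16 = X a ^ 0 * X b ^ 7 * X c ^ 0 := hg 16
  have hg17 : g 17 = X a ^ 0 * X b ^ 6 * X c ^ 4 := hg 17
  have hg18 : g 18 = X a ^ 0 * X b ^ 5 * X c ^ 8 := hg 18
  have hg19 : g 19 = X a ^ 0 * X b ^ 4 * X c ^ 12 := hg 19
  have hg20 : g 20 = X a ^ 0 * X b ^ 3 * X c ^ 16 := hg 20
  have hg21 : g 21 = X a ^ 0 * X b ^ 2 * X c ^ 20 := hg 21
  have hg22 : g 22 = X a ^ 0 * X b ^ 1 * X c ^ 24 := hg 22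
  have hg23 : g 23 = X a ^ 0 * X b ^ 0 * X c ^ 28 := hg 23
  have i1 : Proj.basicOpen (reesGrading (Ideal.span (Set.range g))) (reesT (g 1) (m 1)) ≤
      Proj.basicOpen (reesGrading (Ideal.span (Set.range g))) (reesT (g 0) (m 0)) :=
    JordanFive.basicOpen_reesT_le_of_sq_eq (g 1) (g 0) (g 4) (m 1) (m 0) (m 4)
      (by rw [hg1, hg0, hg4]; ring)
  have i2 : Proj.basicOpen (reesGrading (Ideal.span (Set.range g))) (reesT (g 2) (m 2)) ≤
      Proj.basicOpen (reesGrading (Ideal.span (Set.range g))) (reesT (g 0) (m 0)) :=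
    JordanFive.basicOpen_reesT_le_of_sq_eq (g 2) (g 0) (g 6) (m 2) (m 0) (m 6)
      (by rw [hg2, hg0, hg6]; ring)
  have i3 : Proj.basicOpen (reesGrading (Ideal.span (Set.range g))) (reesT (g 3) (m 3)) ≤
      Proj.basicOpen (reesGrading (Ideal.span (Set.range g))) (reesT (g 0) (m 0)) :=
    JordanFive.basicOpen_reesT_le_of_sq_eq (g 3) (g 0) (g 8) (m 3) (m 0) (m 8)
      (by rw [hg3, hg0, hg8]; ring)
  have i4 : Proj.basicOpen (reesGrading (Ideal.span (Set.range g))) (reesT (g 4) (m 4)) ≤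
      Proj.basicOpen (reesGrading (Ideal.span (Set.range g))) (reesT (g 0) (m 0)) :=
    JordanFive.basicOpen_reesT_le_of_sq_eq (g 4) (g 0) (g 16 * (X b)) (m 4) (m 0) (Ideal.mul_mem_right _ _ (m 16))
      (by rw [hg4, hg0, hg16]; ring)
  have i5 : Proj.basicOpen (reesGrading (Ideal.span (Set.range g))) (reesT (g 5) (m 5)) ≤
      Proj.basicOpen (reesGrading (Ideal.span (Set.range g))) (reesT (g 0) (m 0)) :=
    JordanFive.basicOpen_reesT_le_of_sq_eq (g 5) (g 0) (g 17) (m 5) (m 0) (m 17)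
      (by rw [hg5, hg0, hg17]; ring)
  have i6 : Proj.basicOpen (reesGrading (Ideal.span (Set.range g))) (reesT (g 6) (m 6)) ≤
      Proj.basicOpen (reesGrading (Ideal.span (Set.range g))) (reesT (g 0) (m 0)) :=
    JordanFive.basicOpen_reesT_le_of_sq_eq (g 6) (g 0) (g 19) (m 6) (m 0) (m 19)
      (by rw [hg6, hg0, hg19]; ring)
  have i7 : Proj.basicOpen (reesGrading (Ideal.span (Set.range g))) (reesT (g 7) (m 7)) ≤
      Proj.basicOpen (reesGrading (Ideal.span (Set.range g))) (reesT (g 0) (m 0)) :=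
    JordanFive.basicOpen_reesT_le_of_sq_eq (g 7) (g 0) (g 21) (m 7) (m 0) (m 21)
      (by rw [hg7, hg0, hg21]; ring)
  have i8 : Proj.basicOpen (reesGrading (Ideal.span (Set.range g))) (reesT (g 8) (m 8)) ≤
      Proj.basicOpen (reesGrading (Ideal.span (Set.range g))) (reesT (g 0) (m 0)) :=
    JordanFive.basicOpen_reesT_le_of_sq_eq (g 8) (g 0) (g 23) (m 8) (m 0) (m 23)
      (by rw [hg8, hg0, hg23]; ring)
  have i9 : Proj.basicOpen (reesGrading (Ideal.span (Set.range g))) (reesT (g 9) (m 9)) ≤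
      Proj.basicOpen (reesGrading (Ideal.span (Set.range g))) (reesT (g 16) (m 16)) :=
    JordanFive.basicOpen_reesT_le_of_sq_eq (g 9) (g 16) (g 4 * (X b)) (m 9) (m 16) (Ideal.mul_mem_right _ _ (m 4))
      (by rw [hg9, hg16, hg4]; ring)
  have i10 : Proj.basicOpen (reesGrading (Ideal.span (Set.range g))) (reesT (g 10) (m 10)) ≤
      Proj.basicOpen (reesGrading (Ideal.span (Set.range g))) (reesT (g 16) (m 16)) :=
    JordanFive.basicOpen_reesT_le_of_sq_eq (g 10) (g 16) (g 5) (m 10) (m 16) (m 5)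
      (by rw [hg10, hg16, hg5]; ring)
  have i11 : Proj.basicOpen (reesGrading (Ideal.span (Set.range g))) (reesT (g 11) (m 11)) ≤
      Proj.basicOpen (reesGrading (Ideal.span (Set.range g))) (reesT (g 16) (m 16)) :=
    JordanFive.basicOpen_reesT_le_of_sq_eq (g 11) (g 16) (g 7) (m 11) (m 16) (m 7)
      (by rw [hg11, hg16, hg7]; ring)
  have i12 : Proj.basicOpen (reesGrading (Ideal.span (Set.range g))) (reesT (g 12) (m 12)) ≤
      Proj.basicOpen (reesGrading (Ideal.span (Set.range g))) (reesT (g 16) (m 16)) :=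
    JordanFive.basicOpen_reesT_le_of_cube_eq (g 12) (g 16) (g 2) (g 22) (m 12) (m 16) (m 2) (m 22)
      (by rw [hg12, hg16, hg2, hg22]; ring)
  have i13 : Proj.basicOpen (reesGrading (Ideal.span (Set.range g))) (reesT (g 13) (m 13)) ≤
      Proj.basicOpen (reesGrading (Ideal.span (Set.range g))) (reesT (g 23) (m 23)) :=
    JordanFive.basicOpen_reesT_le_of_cube_eq (g 13) (g 23) (g 2) (g 18) (m 13) (m 23) (m 2) (m 18)
      (by rw [hg13, hg23, hg2, hg18]; ring)
  have i14 : Proj.basicOpen (reesGrading (Ideal.span (Set.range g))) (reesT (g 14) (m 14)) ≤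
      Proj.basicOpen (reesGrading (Ideal.span (Set.range g))) (reesT (g 23) (m 23)) :=
    JordanFive.basicOpen_reesT_le_of_sq_eq (g 14) (g 23) (g 6) (m 14) (m 23) (m 6)
      (by rw [hg14, hg23, hg6]; ring)
  have i15 : Proj.basicOpen (reesGrading (Ideal.span (Set.range g))) (reesT (g 15) (m 15)) ≤
      Proj.basicOpen (reesGrading (Ideal.span (Set.range g))) (reesT (g 23) (m 23)) :=
    JordanFive.basicOpen_reesT_le_of_sq_eq (g 15) (g 23) (g 8) (m 15) (m 23) (m 8)
      (by rw [hg15, hg23, hg8]; ring)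
  have i17 : Proj.basicOpen (reesGrading (Ideal.span (Set.range g))) (reesT (g 17) (m 17)) ≤
      Proj.basicOpen (reesGrading (Ideal.span (Set.range g))) (reesT (g 16) (m 16)) :=
    JordanFive.basicOpen_reesT_le_of_sq_eq (g 17) (g 16) (g 18) (m 17) (m 16) (m 18)
      (by rw [hg17, hg16, hg18]; ring)
  have i18 : Proj.basicOpen (reesGrading (Ideal.span (Set.range g))) (reesT (g 18) (m 18)) ≤
      Proj.basicOpen (reesGrading (Ideal.span (Set.range g))) (reesT (g 16) (m 16)) :=
    JordanFive.basicOpen_reesT_le_of_sq_eq (g 18) (g 16) (g 20) (m 18) (m 16) (m 20)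
      (by rw [hg18, hg16, hg20]; ring)
  have i19 : Proj.basicOpen (reesGrading (Ideal.span (Set.range g))) (reesT (g 19) (m 19)) ≤
      Proj.basicOpen (reesGrading (Ideal.span (Set.range g))) (reesT (g 16) (m 16)) :=
    JordanFive.basicOpen_reesT_le_of_sq_eq (g 19) (g 16) (g 22) (m 19) (m 16) (m 22)
      (by rw [hg19, hg16, hg22]; ring)
  have i20 : Proj.basicOpen (reesGrading (Ideal.span (Set.range g))) (reesT (g 20) (m 20)) ≤
      Proj.basicOpen (reesGrading (Ideal.span (Set.range g))) (reesT (g 23) (m 23)) :=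
    JordanFive.basicOpen_reesT_le_of_sq_eq (g 20) (g 23) (g 17) (m 20) (m 23) (m 17)
      (by rw [hg20, hg23, hg17]; ring)
  have i21 : Proj.basicOpen (reesGrading (Ideal.span (Set.range g))) (reesT (g 21) (m 21)) ≤
      Proj.basicOpen (reesGrading (Ideal.span (Set.range g))) (reesT (g 23) (m 23)) :=
    JordanFive.basicOpen_reesT_le_of_sq_eq (g 21) (g 23) (g 19) (m 21) (m 23) (m 19)
      (by rw [hg21, hg23, hg19]; ring)
  have i22 : Proj.basicOpen (reesGrading (Ideal.span (Set.range g))) (reesT (g 22) (m 22)) ≤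
      Proj.basicOpen (reesGrading (Ideal.span (Set.range g))) (reesT (g 23) (m 23)) :=
    JordanFive.basicOpen_reesT_le_of_sq_eq (g 22) (g 23) (g 21) (m 22) (m 23) (m 21)
      (by rw [hg22, hg23, hg21]; ring)
  refine top_le_iff.mp ?_
  rw [← affineBlowup.iSup_basicOpen_reesT_generators_eq_top g]
  refine iSup_le fun i => ?_
  fin_cases i
  · exact le_sup_left.trans le_sup_left
  · exact i1.trans (le_sup_left.trans le_sup_left)
  · exact i2.trans (le_sup_left.trans le_sup_left)
  · exact i3.trans (le_sup_left.trans le_sup_left)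
  · exact i4.trans (le_sup_left.trans le_sup_left)
  · exact i5.trans (le_sup_left.trans le_sup_left)
  · exact i6.trans (le_sup_left.trans le_sup_left)
  · exact i7.trans (le_sup_left.trans le_sup_left)
  · exact i8.trans (le_sup_left.trans le_sup_left)
  · exact i9.trans (le_sup_right.trans le_sup_left)
  · exact i10.trans (le_sup_right.trans le_sup_left)
  · exact i11.trans (le_sup_right.trans le_sup_left)
  · exact i12.trans (le_sup_right.trans le_sup_left)
  · exact i13.trans (le_sup_right)
  · exact i14.trans (le_sup_right)
  · exact i15.trans (le_sup_right)
  · exact le_sup_right.trans le_sup_left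
  · exact i17.trans (le_sup_right.trans le_sup_left)
  · exact i18.trans (le_sup_right.trans le_sup_left)
  · exact i19.trans (le_sup_right.trans le_sup_left)
  · exact i20.trans (le_sup_right)
  · exact i21.trans (le_sup_right)
  · exact i22.trans (le_sup_right)
  · exact le_sup_right

/-- `k[x] → Γ(Spec k[x], ⊤)` (local shorthand). -/
local notation3 "ι₀" => (Scheme.ΓSpecIso (CommRingCat.of (MvPolynomial (Fin n) k))).inv.hom

/-- **The vertex cover in the principal-chart spelling** `V[x_a⁴] ⊔ V[x_b⁷] ⊔ V[x_c²⁸] = ⊤`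
(`blowupChart (affineBlowup.π I) (affineBlowup.idealSheaf I) ⟨⊤, _⟩ (ι₀ (g j))`, for scaffolds in the
V3U/N4a `blowupChart` mould). [OURS · L1 W4.5c] [folklore] -/
theorem vertexCharts_cover_blowupChart (g : Fin 24 → MvPolynomial (Fin n) k)
    (hg : ∀ q, g q = X a ^ (e24 q).1 * X b ^ (e24 q).2.1 * X c ^ (e24 q).2.2) :
    blowupChart (affineBlowup.π (Ideal.span (Set.range g))) (affineBlowup.idealSheaf (Ideal.span (Set.range g)))
        ⟨⊤, isAffineOpen_top _⟩ (ι₀ (g 0)) ⊔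
      blowupChart (affineBlowup.π (Ideal.span (Set.range g))) (affineBlowup.idealSheaf (Ideal.span (Set.range g)))
        ⟨⊤, isAffineOpen_top _⟩ (ι₀ (g 16)) ⊔
      blowupChart (affineBlowup.π (Ideal.span (Set.range g))) (affineBlowup.idealSheaf (Ideal.span (Set.range g)))
        ⟨⊤, isAffineOpen_top _⟩ (ι₀ (g 23)) = ⊤ := by
  rw [ToricExit.blowupChart_affineBlowup_eq_basicOpen_reesT (g 0) (Ideal.mem_span_range_self (f := g) (x := 0)),
    ToricExit.blowupChart_affineBlowup_eq_basicOpen_reesT (g 16) (Ideal.mem_span_range_self (f := g) (x := 16)),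
    ToricExit.blowupChart_affineBlowup_eq_basicOpen_reesT (g 23) (Ideal.mem_span_range_self (f := g) (x := 23))]
  exact iSup_vertexCharts_eq_top k n a b c g hg

variable (σ : MvPolynomial (Fin n) k ≃ₐ[k] MvPolynomial (Fin n) k) (h0 : σ (X a) = X a)

include h0 in
/-- `γ • g 0 = g 0` for every `γ ∈ ⟨σ̄⟩` (`g 0 = x_a⁴`, `σ̄ x_a = x_a`). [folklore] -/
theorem smul_g0_eq (g : Fin 24 → MvPolynomial (Fin n) k)
    (hg : ∀ q, g q = X a ^ (e24 q).1 * X b ^ (e24 q).2.1 * X c ^ (e24 q).2.2) (γ : Subgroup.zpowers σ) :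
    γ • g 0 = g 0 := by
  have hg0 : g 0 = X a ^ 4 * X b ^ 0 * X c ^ 0 := hg 0
  have hσ0 : σ • g 0 = g 0 := by
    change σ (g 0) = g 0
    rw [hg0, pow_zero, pow_zero, mul_one, mul_one, map_pow, h0]
  obtain ⟨z, hz⟩ := Subgroup.mem_zpowers_iff.mp γ.2
  change (γ : MvPolynomial (Fin n) k ≃ₐ[k] MvPolynomial (Fin n) k) • g 0 = _
  rw [← hz]
  exact MulAction.fixedBy_subset_fixedBy_zpow (MvPolynomial (Fin n) k) σ z hσ0

include h0 in
/-- **The `x_a`-vertex chart `V[x_a⁴]` is `⟨σ̄⟩`-stable** under the lifted action of `Bl_{I₂₈} 𝔸ⁿ` (any `ρ` with the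
affine-quotient law, abstract `hJ`): `x_a⁴` is invariant. Mould `JordanThreeTwo.preimage_chart_a_eq`.
[folklore] -/
theorem preimage_vertexChartA_eq (g : Fin 24 → MvPolynomial (Fin n) k)
    (hg : ∀ q, g q = X a ^ (e24 q).1 * X b ^ (e24 q).2.1 * X c ^ (e24 q).2.2)
    (ρ : ↥(Subgroup.zpowers σ) →* Aut (Spec (CommRingCat.of (MvPolynomial (Fin n) k))))
    (hρ : ∀ γ : ↥(Subgroup.zpowers σ), (ρ γ).hom = Spec.map (CommRingCat.ofHom
      ((MulSemiringAction.toRingEquiv (↥(Subgroup.zpowers σ)) (MvPolynomial (Fin n) k) γ⁻¹ :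
        MvPolynomial (Fin n) k ≃+* MvPolynomial (Fin n) k) :
          MvPolynomial (Fin n) k →+* MvPolynomial (Fin n) k)))
    (hJ : ∀ γ : ↥(Subgroup.zpowers σ),
      (affineBlowup.idealSheaf (Ideal.span (Set.range g))).comap (ρ γ).hom =
        affineBlowup.idealSheaf (Ideal.span (Set.range g)))
    (γ : ↥(Subgroup.zpowers σ)) :
    (((affineBlowup.isBlowup (Ideal.span (Set.range g))).liftAction ρ hJ) γ).hom ⁻¹ᵁ
        blowupChart (affineBlowup.π (Ideal.span (Set.range g)))
          (affineBlowup.idealSheaf (Ideal.span (Set.range g))) ⟨⊤, isAffineOpen_top _⟩ (ι₀ (g 0)) =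
      blowupChart (affineBlowup.π (Ideal.span (Set.range g)))
        (affineBlowup.idealSheaf (Ideal.span (Set.range g))) ⟨⊤, isAffineOpen_top _⟩ (ι₀ (g 0)) :=
  ToricExit.preimage_blowupChart_eq_self_of_action (affineBlowup.isBlowup (Ideal.span (Set.range g))) ρ
    ((affineBlowup.isBlowup (Ideal.span (Set.range g))).liftAction ρ hJ)
    (fun γ => (affineBlowup.isBlowup (Ideal.span (Set.range g))).liftAction_hom_comp ρ hJ γ) hJ
    (ToricExit.ΓSpecIso_inv_mem_idealSheaf_ideal_top (g 0) (Ideal.mem_span_range_self (f := g) (x := 0)))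
    (fun γ => ToricExit.specAction_appTop_ΓSpecIso_inv ρ hρ (g 0) (smul_g0_eq k n a b c σ h0 g hg) γ) γ

end Summit.ResolutionOfSingularities.ResolutionOfSingularities.Theorems.WildQuotientResolution.Z9Peeled

end
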